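import Summits.ResolutionOfSingularities.ResolutionOfSingularities.Theorems.EquisingularLiftEquisingularLiftNatDeltaIso
import Summits.ResolutionOfSingularities.ResolutionOfSingularities.Theorems.EquisingularLiftEquisingularLiftNatHorizChain
import Summits.ResolutionOfSingularities.ResolutionOfSingularities.Theorems.EquisingularLiftEquisingularLiftProjectiveAmbientIntegralFibre
import HarnessLib

/-!
# [OURS · L1 W4.5(b) · EL♮] RUNG T-Δ-ISO «ONE Δ-STEP THEN POINTS» — ISO-INVARIANT (DOWN) form (sibling of …NatDeltaIso.lean,
# p509522; res-L1-w45b-lead-2 TARGETS 2026-08-27T06:52:51Z (3); named to res-D-pv-013 by res-L1-w45b-plan-1 CHAIN v7.1 (B))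

Crux `EquisingularLiftNat` = stmt-ResolutionOfSingularities-20038 (route EquisingularLift), line `sections`; helper file
`--supports … --as helper`. HONEST FRAMING: OURS (cell res-hironaka, slot W4.5(b)); NOT a statement of any manuscript. AI-written,
weaker than expert review. No `sorry`; standard axioms.

THIS FILE = the two theorems of `…NatDeltaIso.lean` with the downstairs hypothesis (DOWN) in its ISO-INVARIANT form (the
inductive-closure property asked only of predicates invariant under isomorphism of schemes; T-TAIL rev 2
`horizChainE1_of_pointResolvableInv`, p510285): strictly weaker, and transportable along `Γ ≅ Γ'` (`pointResolvableInv_of_iso`) —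
the form a specimen with a NON-empty tail uses after identifying `V(closure S₂)_red` with its concrete downstairs model by
uniqueness of blow-ups. Proofs transcribed verbatim.

* `horizChainE1_of_twoSteps_pointResolvableInv` — general base;
* `elNatBody_of_twoSteps_pointResolvableInv` — the item's `q`-spelling, conclusion = the `∃ (P′, σ, S′)` body of `ELNatOver`.

References: …NatPointTail.lean (p508794), …NatPointStep.lean (p505032), …NatOneStep.lean (p505461), …NatHorizChain.lean (p500485);
res-L1-w45b-lead-2 TARGETS 06:52:51Z / MEMO-2 v1.3 §7; res-L1-w45b-plan-1 CHAIN v7.1 — OURS planning texts, index only.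
-/

set_option linter.dupNamespace false -- mandated namespace `Summit.<Summit>.<Problem>` of this single-conjunct summit
set_option linter.overlappingInstances false -- signatures carry `[IsDomain O] [IsDiscreteValuationRing O]`

noncomputable section

open CategoryTheory CategoryTheory.Limits AlgebraicGeometry TopologicalSpace Topology
open MvPolynomial
open Literature.AlgebraicGeometry.Resolution
open AlgebraicGeometry.Scheme.IdealSheafData
open Summit.ResolutionOfSingularities.ResolutionOfSingularities.Theses.EquisingularLift.Split
open Summit.ResolutionOfSingularities.ResolutionOfSingularities.Cruxes.EquisingularLift.StrataSplit

attribute [local instance] MvPolynomial.gradedAlgebra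

namespace Summit.ResolutionOfSingularities.ResolutionOfSingularities.Cruxes.EquisingularLiftNat.Sections

/-! ## Two explicit steps, then the tail -/

/-- **T-Δ-ISO, general base, iso-invariant (DOWN).** As `horizChainE1_of_twoSteps_pointResolvable` with the closure property of
(DOWN) asked only of iso-invariant predicates. [folklore; assembly of p510285] -/
theorem horizChainE1_of_twoSteps_pointResolvableInv (O : Type) [CommRing O] [IsDomain O] [IsDiscreteValuationRing O]
    (P : Scheme.{0}) (q : P ⟶ Spec (.of O)) (Y : Closeds P) (hq : Smooth q) (hqp : IsProper q)
    (hY : (Y : Set P) ⊆ q ⁻¹' {IsLocalRing.closedPoint O}) (hYirr : IsIrreducible (Y : Set P))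
    -- step 1 (level 0)
    (C₁ : P.IdealSheafData) (X₁ : Scheme.{0}) (τ₁ : X₁ ⟶ P) (hτ₁ : IsBlowup τ₁ C₁) (hC₁reg : Scheme.IsRegular C₁.subscheme)
    (hC₁flat : Flat (C₁.subschemeι ≫ 𝟙 P ≫ q))
    (hC₁gen : (𝟙 P : P ⟶ P) '' (C₁.support : Set P) ⊆ {x : P | ¬ IsGenericPoint x (Y : Set P)})
    (hC₁E1 : (C₁.support : Set P) ∩ (𝟙 P ≫ q) ⁻¹' {IsLocalRing.closedPoint O} ⊆ (Y : Set P))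
    -- step 2 (level 1), `S₁ = closure τ₁⁻¹(Y ∖ V(C₁))`
    (C₂ : X₁.IdealSheafData) (X₂ : Scheme.{0}) (τ₂ : X₂ ⟶ X₁) (hτ₂ : IsBlowup τ₂ C₂) (hC₂reg : Scheme.IsRegular C₂.subscheme)
    (hC₂flat : Flat (C₂.subschemeι ≫ τ₁ ≫ q))
    (hC₂gen : τ₁ '' (C₂.support : Set X₁) ⊆ {x : P | ¬ IsGenericPoint x (Y : Set P)})
    (hC₂E1 : (C₂.support : Set X₁) ∩ (τ₁ ≫ q) ⁻¹' {IsLocalRing.closedPoint O} ⊆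
      closure (τ₁ ⁻¹' ((Y : Set P) \ (C₁.support : Set P))))
    -- the multisection device and its admissibility predicate
    (Adm : ∀ Γ : Scheme.{0}, Γ → Prop)
    (hAdm : ∀ (Γ Γ' : Scheme.{0}) (e : Γ ≅ Γ') (x : Γ), Adm Γ x → Adm Γ' (e.hom x))
    (hMS : ∀ (X' : Scheme.{0}) (σ' : X' ⟶ P) (S' : Set X'),
      (∀ Q : (∀ X' : Scheme.{0}, (X' ⟶ P) → Set X' → Prop), Q P (𝟙 P) (Y : Set P) →
        (∀ (X' X'' : Scheme.{0}) (σ' : X' ⟶ P) (Y' : Set X') (C : X'.IdealSheafData) (τ : X'' ⟶ X'),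
          Q X' σ' Y' → IsBlowup τ C → Scheme.IsRegular C.subscheme → Flat (C.subschemeι ≫ σ' ≫ q) →
          σ' '' (C.support : Set X') ⊆ {x | ¬ IsGenericPoint x (Y : Set P)} →
          (C.support : Set X') ∩ (σ' ≫ q) ⁻¹' {IsLocalRing.closedPoint O} ⊆ Y' →
          Q X'' (τ ≫ σ') (closure (τ ⁻¹' (Y' \ (C.support : Set X'))))) → Q X' σ' S') →
      IsLocallyNoetherian X' → Scheme.IsRegular X' → IsProper (σ' ≫ q) →
      ∀ (z : ↥(vanishingIdeal (⟨closure S', isClosed_closure⟩ : Closeds X')).subscheme),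
        IsClosed ({((vanishingIdeal (⟨closure S', isClosed_closure⟩ : Closeds X')).subschemeι z : X')} : Set X') →
        ¬ IsRegularLocalRing ((vanishingIdeal (⟨closure S', isClosed_closure⟩ : Closeds X')).subscheme.presheaf.stalk z) →
        Adm _ z →
        ∃ C : X'.IdealSheafData, Scheme.IsRegular C.subscheme ∧ Flat (C.subschemeι ≫ σ' ≫ q) ∧
          (C.support : Set X') ∩ (σ' ≫ q) ⁻¹' {IsLocalRing.closedPoint O} =
            {((vanishingIdeal (⟨closure S', isClosed_closure⟩ : Closeds X')).subschemeι z : X')} ∧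
          ∃ hzc : IsClosed ({z} : Set ↥(vanishingIdeal (⟨closure S', isClosed_closure⟩ : Closeds X')).subscheme),
            C.comap (vanishingIdeal (⟨closure S', isClosed_closure⟩ : Closeds X')).subschemeι = vanishingIdeal ⟨{z}, hzc⟩)
    -- the downstairs scheme after the two steps and its point-resolvability
    (Γ : Scheme.{0})
    (e : Γ ≅ (vanishingIdeal (⟨closure (closure (τ₂ ⁻¹' (closure (τ₁ ⁻¹' ((Y : Set P) \ (C₁.support : Set P))) \
      (C₂.support : Set X₁)))), isClosed_closure⟩ : Closeds X₂)).subscheme)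
    (hres : ∃ Γs : Scheme.{0}, (∀ R : Scheme.{0} → Prop, (∀ (X X' : Scheme.{0}), Nonempty (X ≅ X') → R X → R X') → R Γ →
      (∀ (Γ₁ Γ₂ : Scheme.{0}) (x : Γ₁) (hx : IsClosed ({x} : Set Γ₁)) (υ : Γ₂ ⟶ Γ₁), R Γ₁ →
        ¬ IsRegularLocalRing (Γ₁.presheaf.stalk x) → Adm Γ₁ x → IsBlowup υ (vanishingIdeal ⟨{x}, hx⟩) → R Γ₂) → R Γs) ∧
      Scheme.IsRegular Γs) :
    ∃ (P' : Scheme.{0}) (σ : P' ⟶ P) (S' : Set P'),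
      (∀ Q : (∀ X' : Scheme.{0}, (X' ⟶ P) → Set X' → Prop), Q P (𝟙 P) (Y : Set P) →
        (∀ (X' X'' : Scheme.{0}) (σ' : X' ⟶ P) (Y' : Set X') (C : X'.IdealSheafData) (τ : X'' ⟶ X'),
          Q X' σ' Y' → IsBlowup τ C → Scheme.IsRegular C.subscheme → Flat (C.subschemeι ≫ σ' ≫ q) →
          σ' '' (C.support : Set X') ⊆ {x | ¬ IsGenericPoint x (Y : Set P)} →
          (C.support : Set X') ∩ (σ' ≫ q) ⁻¹' {IsLocalRing.closedPoint O} ⊆ Y' →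
          Q X'' (τ ≫ σ') (closure (τ ⁻¹' (Y' \ (C.support : Set X'))))) → Q P' σ S') ∧
      Scheme.IsRegular (vanishingIdeal (⟨closure S', isClosed_closure⟩ : Closeds P')).subscheme := by
  classical
  -- the horizontal-E1 closure as a stage predicate
  obtain ⟨Ch, hCh⟩ : ∃ Ch : ∀ X' : Scheme.{0}, (X' ⟶ P) → Set X' → Prop,
      ∀ (X₀ : Scheme.{0}) (σ₀ : X₀ ⟶ P) (S₀ : Set X₀), Ch X₀ σ₀ S₀ ↔
      ∀ Q : (∀ X' : Scheme.{0}, (X' ⟶ P) → Set X' → Prop), Q P (𝟙 P) (Y : Set P) →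
        (∀ (X' X'' : Scheme.{0}) (σ' : X' ⟶ P) (Y' : Set X') (C : X'.IdealSheafData) (τ : X'' ⟶ X'),
          Q X' σ' Y' → IsBlowup τ C → Scheme.IsRegular C.subscheme → Flat (C.subschemeι ≫ σ' ≫ q) →
          σ' '' (C.support : Set X') ⊆ {x | ¬ IsGenericPoint x (Y : Set P)} →
          (C.support : Set X') ∩ (σ' ≫ q) ⁻¹' {IsLocalRing.closedPoint O} ⊆ Y' →
          Q X'' (τ ≫ σ') (closure (τ ⁻¹' (Y' \ (C.support : Set X'))))) → Q X₀ σ₀ S₀ := ⟨_, fun _ _ _ => Iff.rfl⟩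
  have hChain : ∀ (X' : Scheme.{0}) (σ : X' ⟶ P) (S : Set X'), Ch X' σ S → Chain P (Y : Set P) X' σ S :=
    fun X' σ S h Q h0 hs => (hCh X' σ S).mp h Q h0
      (fun X₁ X₂ σ' Y' C τ hQ hb hr _ hg' _ => hs X₁ X₂ σ' Y' C τ hQ hb hr hg')
  have hStep : ∀ (X' X'' : Scheme.{0}) (σ' : X' ⟶ P) (S' : Set X') (C : X'.IdealSheafData) (τ : X'' ⟶ X'),
      Ch X' σ' S' → IsBlowup τ C → Scheme.IsRegular C.subscheme → Flat (C.subschemeι ≫ σ' ≫ q) →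
      σ' '' (C.support : Set X') ⊆ {x | ¬ IsGenericPoint x (Y : Set P)} →
      (C.support : Set X') ∩ (σ' ≫ q) ⁻¹' {IsLocalRing.closedPoint O} ⊆ S' →
      Ch X'' (τ ≫ σ') (closure (τ ⁻¹' (S' \ (C.support : Set X')))) :=
    fun X' X'' σ' S' C τ h hb hr hfl hg' hE => (hCh _ _ _).mpr fun Q h0 hs =>
      hs X' X'' σ' S' C τ ((hCh X' σ' S').mp h Q h0 hs) hb hr hfl hg' hE
  have hCh₀ : Ch P (𝟙 P) (Y : Set P) := (hCh _ _ _).mpr fun Q h0 _ => h0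
  -- the two explicit steps
  have hCh₁ : Ch X₁ (τ₁ ≫ 𝟙 P) (closure (τ₁ ⁻¹' ((Y : Set P) \ (C₁.support : Set P)))) :=
    hStep P X₁ (𝟙 P) (Y : Set P) C₁ τ₁ hCh₀ hτ₁ hC₁reg hC₁flat hC₁gen hC₁E1
  rw [Category.comp_id] at hCh₁
  have hCh₂ : Ch X₂ (τ₂ ≫ τ₁)
      (closure (τ₂ ⁻¹' (closure (τ₁ ⁻¹' ((Y : Set P) \ (C₁.support : Set P))) \ (C₂.support : Set X₁)))) :=
    hStep X₁ X₂ τ₁ _ C₂ τ₂ hCh₁ hτ₂ hC₂reg hC₂flat hC₂gen hC₂E1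
  -- the tail
  have hMS' : ∀ (X' : Scheme.{0}) (σ' : X' ⟶ P) (S' : Set X'), Ch X' σ' S' → IsLocallyNoetherian X' →
      Scheme.IsRegular X' → IsProper (σ' ≫ q) →
      ∀ (z : ↥(vanishingIdeal (⟨closure S', isClosed_closure⟩ : Closeds X')).subscheme),
        IsClosed ({((vanishingIdeal (⟨closure S', isClosed_closure⟩ : Closeds X')).subschemeι z : X')} : Set X') →
        ¬ IsRegularLocalRing ((vanishingIdeal (⟨closure S', isClosed_closure⟩ : Closeds X')).subscheme.presheaf.stalk z) →
        Adm _ z →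
        ∃ C : X'.IdealSheafData, Scheme.IsRegular C.subscheme ∧ Flat (C.subschemeι ≫ σ' ≫ q) ∧
          (C.support : Set X') ∩ (σ' ≫ q) ⁻¹' {IsLocalRing.closedPoint O} =
            {((vanishingIdeal (⟨closure S', isClosed_closure⟩ : Closeds X')).subschemeι z : X')} ∧
          ∃ hzc : IsClosed ({z} : Set ↥(vanishingIdeal (⟨closure S', isClosed_closure⟩ : Closeds X')).subscheme),
            C.comap (vanishingIdeal (⟨closure S', isClosed_closure⟩ : Closeds X')).subschemeι = vanishingIdeal ⟨{z}, hzc⟩ :=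
    fun X' σ' S' h => hMS X' σ' S' ((hCh X' σ' S').mp h)
  obtain ⟨P', σ, S', hChF, hregF⟩ := horizChainE1_of_pointResolvableInv O P q Y Ch hChain hStep hq hqp hY hYirr Adm hAdm hMS'
    X₂ (τ₂ ≫ τ₁) _ hCh₂ Γ e hres
  exact ⟨P', σ, S', (hCh P' σ S').mp hChF, hregF⟩

/-! ## The item's `q`-spelling: `P = ℙⁿ_O`, `Y = (ι ≫ Proj.map φ)(H)` -/

/-- **RUNG T-Δ-ISO, `q`-spelling, iso-invariant (DOWN).** As `elNatBody_of_twoSteps_pointResolvable` with the closure property of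
(DOWN) asked only of iso-invariant predicates. [folklore; assembly] -/
theorem elNatBody_of_twoSteps_pointResolvableInv (O : Type) [CommRing O] [IsDomain O] [IsDiscreteValuationRing O]
    (k : Type) [Field k] (π : O →+* k) (hπ : Function.Surjective π) (n : ℕ) (H : Scheme.{0})
    (ι : H ⟶ Proj (homogeneousSubmodule (Fin (n + 1)) k)) [IsClosedImmersion ι] [IsIntegral H]
    (φ : homogeneousSubmodule (Fin (n + 1)) O →+*ᵍ homogeneousSubmodule (Fin (n + 1)) k)
    (hφ' : HomogeneousIdeal.irrelevant (homogeneousSubmodule (Fin (n + 1)) k) ≤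
      (HomogeneousIdeal.irrelevant (homogeneousSubmodule (Fin (n + 1)) O)).map φ)
    (hφ : ∀ s, φ s = MvPolynomial.map π s)
    -- step 1 (level 0) out of `(ℙⁿ_O, 𝟙, Y)`
    (C₁ : (Proj (homogeneousSubmodule (Fin (n + 1)) O)).IdealSheafData) (X₁ : Scheme.{0})
    (τ₁ : X₁ ⟶ Proj (homogeneousSubmodule (Fin (n + 1)) O)) (hτ₁ : IsBlowup τ₁ C₁) (hC₁reg : Scheme.IsRegular C₁.subscheme)
    (hC₁flat : Flat (C₁.subschemeι ≫ 𝟙 _ ≫ (Proj.toSpecZero (homogeneousSubmodule (Fin (n + 1)) O) ≫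
      Spec.map (CommRingCat.ofHom (algebraMap O (homogeneousSubmodule (Fin (n + 1)) O 0))))))
    (hC₁gen : (𝟙 (Proj (homogeneousSubmodule (Fin (n + 1)) O)) : _ ⟶ _) '' (C₁.support : Set _) ⊆
      {x | ¬ IsGenericPoint x (Set.range (ι ≫ Proj.map φ hφ'))})
    (hC₁E1 : (C₁.support : Set _) ∩ (𝟙 (Proj (homogeneousSubmodule (Fin (n + 1)) O)) ≫
      (Proj.toSpecZero (homogeneousSubmodule (Fin (n + 1)) O) ≫
        Spec.map (CommRingCat.ofHom (algebraMap O (homogeneousSubmodule (Fin (n + 1)) O 0))))) ⁻¹'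
        {IsLocalRing.closedPoint O} ⊆ Set.range (ι ≫ Proj.map φ hφ'))
    -- step 2 (level 1) out of `(X₁, τ₁, S₁)`
    (C₂ : X₁.IdealSheafData) (X₂ : Scheme.{0}) (τ₂ : X₂ ⟶ X₁) (hτ₂ : IsBlowup τ₂ C₂) (hC₂reg : Scheme.IsRegular C₂.subscheme)
    (hC₂flat : Flat (C₂.subschemeι ≫ τ₁ ≫ (Proj.toSpecZero (homogeneousSubmodule (Fin (n + 1)) O) ≫
      Spec.map (CommRingCat.ofHom (algebraMap O (homogeneousSubmodule (Fin (n + 1)) O 0))))))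
    (hC₂gen : τ₁ '' (C₂.support : Set X₁) ⊆ {x | ¬ IsGenericPoint x (Set.range (ι ≫ Proj.map φ hφ'))})
    (hC₂E1 : (C₂.support : Set X₁) ∩ (τ₁ ≫ (Proj.toSpecZero (homogeneousSubmodule (Fin (n + 1)) O) ≫
      Spec.map (CommRingCat.ofHom (algebraMap O (homogeneousSubmodule (Fin (n + 1)) O 0))))) ⁻¹'
        {IsLocalRing.closedPoint O} ⊆
      closure (τ₁ ⁻¹' (Set.range (ι ≫ Proj.map φ hφ') \ (C₁.support : Set _))))
    -- the multisection device
    (Adm : ∀ Γ : Scheme.{0}, Γ → Prop)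
    (hAdm : ∀ (Γ Γ' : Scheme.{0}) (e : Γ ≅ Γ') (x : Γ), Adm Γ x → Adm Γ' (e.hom x))
    (hMS : ∀ (X' : Scheme.{0}) (σ' : X' ⟶ Proj (homogeneousSubmodule (Fin (n + 1)) O)) (S' : Set X'),
      (∀ Q : (∀ X' : Scheme.{0}, (X' ⟶ Proj (homogeneousSubmodule (Fin (n + 1)) O)) → Set X' → Prop),
        Q (Proj (homogeneousSubmodule (Fin (n + 1)) O)) (𝟙 _) (Set.range (ι ≫ Proj.map φ hφ')) →
        (∀ (X' X'' : Scheme.{0}) (σ' : X' ⟶ Proj (homogeneousSubmodule (Fin (n + 1)) O)) (Y' : Set X')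
          (C : X'.IdealSheafData) (τ : X'' ⟶ X'),
          Q X' σ' Y' → IsBlowup τ C → Scheme.IsRegular C.subscheme →
          Flat (C.subschemeι ≫ σ' ≫ (Proj.toSpecZero (homogeneousSubmodule (Fin (n + 1)) O) ≫
            Spec.map (CommRingCat.ofHom (algebraMap O (homogeneousSubmodule (Fin (n + 1)) O 0))))) →
          σ' '' (C.support : Set X') ⊆ {x | ¬ IsGenericPoint x (Set.range (ι ≫ Proj.map φ hφ'))} →
          (C.support : Set X') ∩ (σ' ≫ (Proj.toSpecZero (homogeneousSubmodule (Fin (n + 1)) O) ≫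
            Spec.map (CommRingCat.ofHom (algebraMap O (homogeneousSubmodule (Fin (n + 1)) O 0))))) ⁻¹'
            {IsLocalRing.closedPoint O} ⊆ Y' →
          Q X'' (τ ≫ σ') (closure (τ ⁻¹' (Y' \ (C.support : Set X'))))) → Q X' σ' S') →
      IsLocallyNoetherian X' → Scheme.IsRegular X' →
      IsProper (σ' ≫ (Proj.toSpecZero (homogeneousSubmodule (Fin (n + 1)) O) ≫
        Spec.map (CommRingCat.ofHom (algebraMap O (homogeneousSubmodule (Fin (n + 1)) O 0))))) →
      ∀ (z : ↥(vanishingIdeal (⟨closure S', isClosed_closure⟩ : Closeds X')).subscheme),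
        IsClosed ({((vanishingIdeal (⟨closure S', isClosed_closure⟩ : Closeds X')).subschemeι z : X')} : Set X') →
        ¬ IsRegularLocalRing ((vanishingIdeal (⟨closure S', isClosed_closure⟩ : Closeds X')).subscheme.presheaf.stalk z) →
        Adm _ z →
        ∃ C : X'.IdealSheafData, Scheme.IsRegular C.subscheme ∧
          Flat (C.subschemeι ≫ σ' ≫ (Proj.toSpecZero (homogeneousSubmodule (Fin (n + 1)) O) ≫
            Spec.map (CommRingCat.ofHom (algebraMap O (homogeneousSubmodule (Fin (n + 1)) O 0))))) ∧
          (C.support : Set X') ∩ (σ' ≫ (Proj.toSpecZero (homogeneousSubmodule (Fin (n + 1)) O) ≫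
            Spec.map (CommRingCat.ofHom (algebraMap O (homogeneousSubmodule (Fin (n + 1)) O 0))))) ⁻¹'
            {IsLocalRing.closedPoint O} =
            {((vanishingIdeal (⟨closure S', isClosed_closure⟩ : Closeds X')).subschemeι z : X')} ∧
          ∃ hzc : IsClosed ({z} : Set ↥(vanishingIdeal (⟨closure S', isClosed_closure⟩ : Closeds X')).subscheme),
            C.comap (vanishingIdeal (⟨closure S', isClosed_closure⟩ : Closeds X')).subschemeι = vanishingIdeal ⟨{z}, hzc⟩)
    -- the downstairs scheme after the two steps and its point-resolvability
    (Γ : Scheme.{0})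
    (e : Γ ≅ (vanishingIdeal (⟨closure (closure (τ₂ ⁻¹' (closure (τ₁ ⁻¹' (Set.range (ι ≫ Proj.map φ hφ') \
      (C₁.support : Set _))) \ (C₂.support : Set X₁)))), isClosed_closure⟩ : Closeds X₂)).subscheme)
    (hres : ∃ Γs : Scheme.{0}, (∀ R : Scheme.{0} → Prop, (∀ (X X' : Scheme.{0}), Nonempty (X ≅ X') → R X → R X') → R Γ →
      (∀ (Γ₁ Γ₂ : Scheme.{0}) (x : Γ₁) (hx : IsClosed ({x} : Set Γ₁)) (υ : Γ₂ ⟶ Γ₁), R Γ₁ →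
        ¬ IsRegularLocalRing (Γ₁.presheaf.stalk x) → Adm Γ₁ x → IsBlowup υ (vanishingIdeal ⟨{x}, hx⟩) → R Γ₂) → R Γs) ∧
      Scheme.IsRegular Γs) :
    ∀ Y : Set (Proj (homogeneousSubmodule (Fin (n + 1)) O)), Y = Set.range (ι ≫ Proj.map φ hφ') →
    ∃ (P' : Scheme.{0}) (σ : P' ⟶ Proj (homogeneousSubmodule (Fin (n + 1)) O)) (S' : Set P'),
      (∀ Q : (∀ X' : Scheme.{0}, (X' ⟶ Proj (homogeneousSubmodule (Fin (n + 1)) O)) → Set X' → Prop),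
        Q (Proj (homogeneousSubmodule (Fin (n + 1)) O)) (𝟙 _) Y →
        (∀ (X' X'' : Scheme.{0}) (σ' : X' ⟶ Proj (homogeneousSubmodule (Fin (n + 1)) O)) (Y' : Set X')
          (C : X'.IdealSheafData) (τ : X'' ⟶ X'), Q X' σ' Y' → IsBlowup τ C → Scheme.IsRegular C.subscheme →
          σ' '' (C.support : Set X') ⊆ {x | ¬ IsGenericPoint x Y} →
          (C.support : Set X') ∩ (σ' ≫ (Proj.toSpecZero (homogeneousSubmodule (Fin (n + 1)) O) ≫
            Spec.map (CommRingCat.ofHom (algebraMap O (homogeneousSubmodule (Fin (n + 1)) O 0))))) ⁻¹'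
            {IsLocalRing.closedPoint O} ⊆ Y' →
          Q X'' (τ ≫ σ') (closure (τ ⁻¹' (Y' \ (C.support : Set X'))))) → Q P' σ S') ∧
      IsIrreducible ((σ ≫ (Proj.toSpecZero (homogeneousSubmodule (Fin (n + 1)) O) ≫
        Spec.map (CommRingCat.ofHom (algebraMap O (homogeneousSubmodule (Fin (n + 1)) O 0))))) ⁻¹'
        {IsLocalRing.closedPoint O}) ∧
      Scheme.IsRegular (vanishingIdeal (⟨closure S', isClosed_closure⟩ : Closeds P')).subscheme := by
  classical
  set q : (Proj (homogeneousSubmodule (Fin (n + 1)) O)) ⟶ Spec (.of O) := Proj.toSpecZero (homogeneousSubmodule (Fin (n + 1)) O) ≫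
    Spec.map (CommRingCat.ofHom (algebraMap O (homogeneousSubmodule (Fin (n + 1)) O 0))) with hqdef
  set g : Proj (homogeneousSubmodule (Fin (n + 1)) k) ⟶ (Proj (homogeneousSubmodule (Fin (n + 1)) O)) := Proj.map φ hφ' with hgdef
  intro Y hY
  subst hY
  -- the special fibre is the range of the closed immersion `g`
  have hP := ProjectiveAmbientFibre.isPullback_projMap π φ hφ hπ hφ'
  haveI : IsClosedImmersion (Spec.map (CommRingCat.ofHom π)) := IsClosedImmersion.spec_of_surjective _ hπ
  haveI : IsClosedImmersion g := MorphismProperty.IsStableUnderBaseChange.of_isPullback hP.flip inferInstance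
  have hpt : ∀ x : Spec (.of k), Spec.map (CommRingCat.ofHom π) x = IsLocalRing.closedPoint O := by
    intro x
    rw [Spec.map_apply]
    apply PrimeSpectrum.ext
    rw [PrimeSpectrum.comap_asIdeal, CommRingCat.hom_ofHom, Ideal.eq_bot_of_prime x.asIdeal, ← RingHom.ker_eq_comap_bot]
    exact IsLocalRing.eq_maximalIdeal (RingHom.ker_isMaximal_of_surjective π hπ)
  have hgq : ∀ x, q (g x) = IsLocalRing.closedPoint O := fun x ↦
    (Scheme.Hom.comp_apply g q x).symm.trans
      ((congrArg (fun h : Proj (homogeneousSubmodule (Fin (n + 1)) k) ⟶ Spec (.of O) ↦ h x) hP.w).trans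
        ((Scheme.Hom.comp_apply _ _ x).trans (hpt _)))
  -- the closed immersion `f = ι ≫ g` and its range `Y`
  let f : H ⟶ (Proj (homogeneousSubmodule (Fin (n + 1)) O)) := ι ≫ g
  let Yc : Closeds (Proj (homogeneousSubmodule (Fin (n + 1)) O)) := ⟨Set.range f, f.isClosedEmbedding.isClosed_range⟩
  have hYc : (Yc : Set (Proj (homogeneousSubmodule (Fin (n + 1)) O))) = Set.range (ι ≫ g) := rfl
  have hYs : (Yc : Set (Proj (homogeneousSubmodule (Fin (n + 1)) O))) ⊆ q ⁻¹' {IsLocalRing.closedPoint O} := by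
    rintro _ ⟨x, rfl⟩
    show q (f x) = IsLocalRing.closedPoint O
    rw [show f x = g (ι x) from Scheme.Hom.comp_apply _ _ x]
    exact hgq (ι x)
  have hYirr : IsIrreducible (Yc : Set (Proj (homogeneousSubmodule (Fin (n + 1)) O))) := by
    have h := (IrreducibleSpace.isIrreducible_univ H).image f f.continuous.continuousOn
    rwa [Set.image_univ] at h
  obtain ⟨hsm, hprop⟩ := stub_projectiveAmbientSmoothProper O n
  have hint := isIntegral_pullback_projectiveSpace_residue O n
  -- two steps and the tail
  obtain ⟨P', σ, S', hChF, hregF⟩ := horizChainE1_of_twoSteps_pointResolvableInv O _ q Yc hsm hprop hYs hYirr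
    C₁ X₁ τ₁ hτ₁ hC₁reg hC₁flat hC₁gen hC₁E1 C₂ X₂ τ₂ hτ₂ hC₂reg hC₂flat hC₂gen hC₂E1 Adm hAdm hMS Γ e hres
  -- horizontal E1 chain ⇒ item E1-chain and irreducible special fibre
  obtain ⟨hchain, hirr⟩ := natChain_and_isIrreducible_of_horizChainE1 O _ P' q (Yc : Set _) σ S' hsm hprop hint hYirr
    Yc.isClosed hYs hChF
  exact ⟨P', σ, S', hchain, hirr, hregF⟩

end Summit.ResolutionOfSingularities.ResolutionOfSingularities.Cruxes.EquisingularLiftNat.Sections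

end
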